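import Mathlib
import Summits.PneNP.PneNP.Theorems.OverlapGapAlgebraSearchHardWindowLipschitzRungDegree
import Summits.PneNP.PneNP.Theorems.OverlapGapAlgebraSolvableImpliesStableSectionLipschitzTransferTypicalVariance

/-!
# PneNP / OverlapGapAlgebra — crux `SolvableImpliesStableSection` (stmt-PneNP-2463):
# the TYPICALLY-Lipschitz transfer (2/3) — validity half and the exceptional set

Support for crux `stmt-PneNP-2463` (`Summit.PneNP.PneNP.Theses.OverlapGapAlgebra.SolvableImpliesStableSection`).
Two fixed-`(k, m, n)` lemmas for the typically-Lipschitz transfer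
(`OverlapGapAlgebraSolvableImpliesStableSectionLipschitzTransferTypical.lean`):

* `sissT_km_card_invalid_le` — validity half with the exceptional set: if `g` is `s`-Lipschitz per
  single-literal change at instances of maximum clause-degree `≤ L + 1`, `∑_Φ D(Φ)² ≤ 10 log² n · #Inst`,
  `m²·#{Φ : L < D Φ} ≤ #Inst`, `g` satisfies `≥ ε·#Inst` instances and `8(2 + 10k²s²log²n) ≤ εν²m`, then
  `(k m)·#{V_g > ν m} ≤ 4k(2 + 10k²s²log²n)/ν² · #Inst` (`sissT_sum_sq_dev_le` + boost + Chebyshev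
  `shwLip_card_gt_le_of_zeroSet`);
* `sissT_bad_bounds` — the exceptional set `{Φ : L < D Φ}` at level `L ≥ 2 log n` is a `O(n^{-3})`
  fraction (`shwL_card_maxdeg_gt_le_real`), whence `m²·#Bad ≤ #Inst` and `(m k)·#Bad ≤ (8k/ν²)·#Inst`
  for `n` beyond two explicit thresholds.
No new definitions; axioms `propext`, `Classical.choice`, `Quot.sound`.
-/

set_option linter.dupNamespace false -- `Summit.PneNP.PneNP.…`: summit = sub-problem (D-0017)

namespace Summit.PneNP.PneNP.Theorems

open Finset Filter
open scoped Classical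

section Boost

variable {m k n : ℕ}

/-- **Validity half of the typically-Lipschitz transfer (fixed `k, m, n`).** Let `g` be `s`-Lipschitz
per single-literal change at every instance of maximum clause-degree `≤ L + 1` (`0 ≤ s`), let
`∑_Φ D(Φ)² ≤ 10 log² n · #Inst`, `m² · #{Φ : L < D Φ} ≤ #Inst`, let `g` satisfy at least `ε·#Inst`
instances, and `8(2 + 10 k² s² log² n) ≤ ε ν² m`. Then `G = {Φ : V_g Φ ≤ ν m}` has
`(k m)·#Gᶜ ≤ 4k(2 + 10k² s² log² n)/ν² · #Inst`. -/
theorem sissT_km_card_invalid_le (hn : 1 ≤ n) (hm : 1 ≤ m)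
    (g : (Fin m → Fin k → Fin n × Bool) → (Fin n → Bool)) (s ν ε : ℝ) (hs : 0 ≤ s)
    (hν : 0 < ν) (hε : 0 < ε) (L : ℕ)
    (hg : ∀ (Φ : Fin m → Fin k → Fin n × Bool),
      ((univ : Finset (Fin n)).sup fun v =>
        ((univ : Finset (Fin m)).filter fun i => ∃ j, (Φ i j).1 = v).card) ≤ L + 1 →
      ∀ (a : Fin m) (b : Fin k) (ℓ : Fin n × Bool),
        (hammingDist (g Φ) (g (Function.update Φ a (Function.update (Φ a) b ℓ))) : ℝ) ≤ s)
    (hD : ∑ Φ : Fin m → Fin k → Fin n × Bool,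
        (((univ : Finset (Fin n)).sup fun v =>
          ((univ : Finset (Fin m)).filter fun i => ∃ j, (Φ i j).1 = v).card : ℕ) : ℝ) ^ 2
      ≤ 10 * Real.log n ^ 2 * Fintype.card (Fin m → Fin k → Fin n × Bool))
    (hBad : (m : ℝ) ^ 2 * (((univ : Finset (Fin m → Fin k → Fin n × Bool)).filter fun Φ =>
        L < (univ : Finset (Fin n)).sup fun v =>
          ((univ : Finset (Fin m)).filter fun i => ∃ j, (Φ i j).1 = v).card).card : ℝ)
      ≤ Fintype.card (Fin m → Fin k → Fin n × Bool))
    (hsucc : ε * Fintype.card (Fin m → Fin k → Fin n × Bool) ≤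
      ((Finset.univ.filter fun Φ : Fin m → Fin k → Fin n × Bool =>
        ∀ i, ∃ j, g Φ (Φ i j).1 = (Φ i j).2).card : ℝ))
    (h8B : 8 * (2 + 10 * k ^ 2 * s ^ 2 * Real.log n ^ 2) ≤ ε * ν ^ 2 * m)
    (G : Finset (Fin m → Fin k → Fin n × Bool))
    (hGdef : G = (univ : Finset (Fin m → Fin k → Fin n × Bool)).filter fun Φ =>
      ((((univ : Finset (Fin m)).filter fun i => ∀ j, g Φ (Φ i j).1 ≠ (Φ i j).2).card : ℕ) : ℝ)
        ≤ ν * m) :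
    ((k * m : ℕ) : ℝ) * (Gᶜ.card : ℝ)
      ≤ 4 * k * (2 + 10 * k ^ 2 * s ^ 2 * Real.log n ^ 2) / ν ^ 2 *
          Fintype.card (Fin m → Fin k → Fin n × Bool) := by
  haveI : Nonempty (Fin n × Bool) := ⟨(⟨0, hn⟩, true)⟩
  have hmR : (1 : ℝ) ≤ m := by exact_mod_cast hm
  have hmpos' : (0 : ℝ) < m := by linarith only [hmR]
  set N : ℝ := (Fintype.card (Fin m → Fin k → Fin n × Bool) : ℝ) with hN
  have hNpos : 0 < N := by rw [hN]; exact_mod_cast Fintype.card_pos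
  -- Efron–Stein variance bound with the exceptional set
  have hW := sissT_sum_sq_dev_le hn g s hs L hg
  set SumD : ℝ := ∑ Φ : Fin m → Fin k → Fin n × Bool,
      (((univ : Finset (Fin n)).sup fun v =>
        ((univ : Finset (Fin m)).filter fun i => ∃ j, (Φ i j).1 = v).card : ℕ) : ℝ) ^ 2 with hSumD
  set Bad : ℝ := (((univ : Finset (Fin m → Fin k → Fin n × Bool)).filter fun Φ =>
      L < (univ : Finset (Fin n)).sup fun v =>
        ((univ : Finset (Fin m)).filter fun i => ∃ j, (Φ i j).1 = v).card).card : ℝ) with hBadDef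
  set B : ℝ := 2 + 10 * k ^ 2 * s ^ 2 * Real.log n ^ 2 with hB
  set W : ℝ := m * (N + (k : ℝ) ^ 2 * s ^ 2 * SumD + (m : ℝ) ^ 2 * Bad) with hWdef
  have hBpos : 0 < B := by rw [hB]; positivity
  have hWB : W ≤ m * N * B := by
    have h1 : (k : ℝ) ^ 2 * s ^ 2 * SumD ≤ (k : ℝ) ^ 2 * s ^ 2 * (10 * Real.log n ^ 2 * N) :=
      mul_le_mul_of_nonneg_left hD (by positivity)
    calc W = m * (N + (k : ℝ) ^ 2 * s ^ 2 * SumD + (m : ℝ) ^ 2 * Bad) := rfl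
      _ ≤ m * (N + (k : ℝ) ^ 2 * s ^ 2 * (10 * Real.log n ^ 2 * N) + N) := by gcongr
      _ = m * N * B := by rw [hB]; ring
  -- (E1) the boost condition `4 W ≤ (ε/2) N (ν m)²`
  have hE1 : 4 * W ≤ ε / 2 * N * (ν * m) ^ 2 := by
    calc 4 * W ≤ 4 * (m * N * B) := by linarith only [hWB]
      _ = (m * N) * (4 * B) := by ring
      _ ≤ (m * N) * (ε * ν ^ 2 * m / 2) := by
          apply mul_le_mul_of_nonneg_left _ (by positivity)
          linarith only [h8B]
      _ = ε / 2 * N * (ν * m) ^ 2 := by ring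
  -- the zero set of `V_g` contains the solved instances
  have hZ : ∀ Φ ∈ ((univ : Finset (Fin m → Fin k → Fin n × Bool)).filter
      fun Φ => ∀ i, ∃ j, g Φ (Φ i j).1 = (Φ i j).2),
      (fun Ψ : Fin m → Fin k → Fin n × Bool =>
        ((((univ : Finset (Fin m)).filter fun i => ∀ j, g Ψ (Ψ i j).1 ≠ (Ψ i j).2).card : ℕ) : ℝ)) Φ
        = 0 := by
    intro Φ hΦ
    simp only [mem_filter, mem_univ, true_and] at hΦ
    simp only [Nat.cast_eq_zero, Finset.card_eq_zero, Finset.filter_eq_empty_iff]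
    intro i _ hall
    obtain ⟨j, hj⟩ := hΦ i
    exact hall j hj
  have hV0 : ∀ Φ : Fin m → Fin k → Fin n × Bool, 0 ≤ (fun Ψ : Fin m → Fin k → Fin n × Bool =>
      ((((univ : Finset (Fin m)).filter fun i => ∀ j, g Ψ (Ψ i j).1 ≠ (Ψ i j).2).card : ℕ) : ℝ)) Φ :=
    fun Φ => Nat.cast_nonneg _
  have hνm : 0 < ν * m := by positivity
  have hε2 : 0 < ε / 2 := by positivity
  have hlt' : ε / 2 * (Fintype.card (Fin m → Fin k → Fin n × Bool) : ℝ)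
      < (((univ : Finset (Fin m → Fin k → Fin n × Bool)).filter
          fun Φ => ∀ i, ∃ j, g Φ (Φ i j).1 = (Φ i j).2).card : ℝ) := by
    have h2 : 0 < ε / 2 * N := by positivity
    have : ε / 2 * N < ε * N := by linarith only [h2]
    exact this.trans_le hsucc
  have hboost := shwLip_card_gt_le_of_zeroSet
    (fun Ψ : Fin m → Fin k → Fin n × Bool =>
      ((((univ : Finset (Fin m)).filter fun i => ∀ j, g Ψ (Ψ i j).1 ≠ (Ψ i j).2).card : ℕ) : ℝ))
    hV0 W (ε / 2) (ν * m) hε2 hνm hW _ hZ hlt' hE1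
  -- `Gᶜ = {ν m < V_g}`
  have hset : Gᶜ = (univ : Finset (Fin m → Fin k → Fin n × Bool)).filter fun Φ =>
      ν * m < ((((univ : Finset (Fin m)).filter fun i =>
        ∀ j, g Φ (Φ i j).1 ≠ (Φ i j).2).card : ℕ) : ℝ) := by
    rw [hGdef, Finset.compl_filter]
    exact Finset.filter_congr fun Φ _ => by simp only [not_le]
  rw [hset]
  have hm0' : (m : ℝ) ≠ 0 := hmpos'.ne'
  have hν0 : ν ≠ 0 := hν.ne'
  have hrew : (k : ℝ) * m * (4 * (m * N * B) / (ν * m) ^ 2) = 4 * k * B / ν ^ 2 * N := by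
    field_simp
  calc _ ≤ ((k * m : ℕ) : ℝ) * (4 * W / (ν * m) ^ 2) :=
        mul_le_mul_of_nonneg_left hboost (Nat.cast_nonneg _)
    _ ≤ ((k * m : ℕ) : ℝ) * (4 * (m * N * B) / (ν * m) ^ 2) := by
        apply mul_le_mul_of_nonneg_left _ (Nat.cast_nonneg _)
        apply div_le_div_of_nonneg_right _ (by positivity)
        linarith only [hWB]
    _ = 4 * k * B / ν ^ 2 * N := by push_cast; exact hrew

end Boost

section Bad

variable {m k n : ℕ}

/-- **The exceptional set is negligible.** At level `L ≥ 2 log n` the instances of maximum clause-degree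
`> L` number at most `e^{αke²}·#Inst/n³` (`shwL_card_maxdeg_gt_le_real` with `e^{-2(L+1)} ≤ n^{-4}`); so
for `n ≥ α² e^{αke²}` and `n ≥ α ν² e^{αke²}` (and `m ≤ α n`): `m²·#Bad ≤ #Inst` and
`(m k)·#Bad ≤ (8k/ν²)·#Inst`. -/
theorem sissT_bad_bounds (hn : 1 ≤ n) (α ν : ℝ) (hα : 0 ≤ α) (hν : 0 < ν) (L : ℕ)
    (hm_le : (m : ℝ) ≤ α * n) (hLge : 2 * Real.log n ≤ L)
    (hC7 : α ^ 2 * Real.exp (α * k * Real.exp 2) ≤ (n : ℝ))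
    (hC8 : α * ν ^ 2 * Real.exp (α * k * Real.exp 2) ≤ (n : ℝ)) :
    (m : ℝ) ^ 2 * (((univ : Finset (Fin m → Fin k → Fin n × Bool)).filter fun Φ =>
        L < (univ : Finset (Fin n)).sup fun v =>
          ((univ : Finset (Fin m)).filter fun i => ∃ j, (Φ i j).1 = v).card).card : ℝ)
      ≤ Fintype.card (Fin m → Fin k → Fin n × Bool) ∧
    ((m * k : ℕ) : ℝ) * (((univ : Finset (Fin m → Fin k → Fin n × Bool)).filter fun Φ =>
        L < (univ : Finset (Fin n)).sup fun v =>
          ((univ : Finset (Fin m)).filter fun i => ∃ j, (Φ i j).1 = v).card).card : ℝ)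
      ≤ 8 * k / ν ^ 2 * Fintype.card (Fin m → Fin k → Fin n × Bool) := by
  have hnR : (1 : ℝ) ≤ n := by exact_mod_cast hn
  have hnpos : (0 : ℝ) < n := by linarith only [hnR]
  set N : ℝ := (Fintype.card (Fin m → Fin k → Fin n × Bool) : ℝ) with hN
  have hNnn : 0 ≤ N := by rw [hN]; exact Nat.cast_nonneg _
  set Bad : ℝ := (((univ : Finset (Fin m → Fin k → Fin n × Bool)).filter fun Φ =>
      L < (univ : Finset (Fin n)).sup fun v =>
        ((univ : Finset (Fin m)).filter fun i => ∃ j, (Φ i j).1 = v).card).card : ℝ) with hBadDef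
  have hBadnn : 0 ≤ Bad := by rw [hBadDef]; exact Nat.cast_nonneg _
  have htail := shwL_card_maxdeg_gt_le_real (m := m) (k := k) (n := n) L hα hn hm_le
  have hexpL : Real.exp (-(2 * (L + 1))) ≤ ((n : ℝ) ^ 4)⁻¹ := by
    have h4 : 4 * Real.log n ≤ 2 * (L + 1 : ℝ) := by linarith
    rw [Real.exp_neg]
    apply inv_anti₀ (by positivity)
    calc (n : ℝ) ^ 4 = Real.exp (4 * Real.log n) := by
          rw [show (4 : ℝ) * Real.log n = ((4 : ℕ) : ℝ) * Real.log n by norm_num, Real.exp_nat_mul,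
            Real.exp_log hnpos]
      _ ≤ Real.exp (2 * (L + 1)) := Real.exp_le_exp.2 (by exact_mod_cast h4)
  set E : ℝ := Real.exp (α * k * Real.exp 2) with hE
  have hEpos : 0 < E := Real.exp_pos _
  have hBad3 : Bad * (n : ℝ) ^ 3 ≤ E * N := by
    have h1 : Bad ≤ n * (E * ((n : ℝ) ^ 4)⁻¹) * N := by
      calc Bad ≤ n * (E * Real.exp (-(2 * (L + 1)))) * N := htail
        _ ≤ n * (E * ((n : ℝ) ^ 4)⁻¹) * N := by gcongr
    have h2 : n * (E * ((n : ℝ) ^ 4)⁻¹) * N * (n : ℝ) ^ 3 = E * N := by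
      field_simp
    calc Bad * (n : ℝ) ^ 3 ≤ n * (E * ((n : ℝ) ^ 4)⁻¹) * N * (n : ℝ) ^ 3 :=
          mul_le_mul_of_nonneg_right h1 (by positivity)
      _ = E * N := h2
  constructor
  · -- `m² #Bad ≤ N`
    have hm2 : (m : ℝ) ^ 2 ≤ (α * n) ^ 2 := pow_le_pow_left₀ (Nat.cast_nonneg m) hm_le 2
    have h1 : (m : ℝ) ^ 2 * Bad * n ≤ (α * n) ^ 2 * Bad * n :=
      mul_le_mul_of_nonneg_right (mul_le_mul_of_nonneg_right hm2 hBadnn) hnpos.le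
    have h2 : (α * n) ^ 2 * Bad * n = α ^ 2 * (Bad * (n : ℝ) ^ 3) := by ring
    have h3 : α ^ 2 * (Bad * (n : ℝ) ^ 3) ≤ α ^ 2 * (E * N) :=
      mul_le_mul_of_nonneg_left hBad3 (sq_nonneg α)
    have h4 : α ^ 2 * (E * N) ≤ n * N := by
      rw [← mul_assoc]
      exact mul_le_mul_of_nonneg_right hC7 hNnn
    have h5 : (m : ℝ) ^ 2 * Bad * n ≤ N * n := by
      calc (m : ℝ) ^ 2 * Bad * n ≤ (α * n) ^ 2 * Bad * n := h1
        _ = α ^ 2 * (Bad * (n : ℝ) ^ 3) := h2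
        _ ≤ α ^ 2 * (E * N) := h3
        _ ≤ n * N := h4
        _ = N * n := mul_comm _ _
    exact le_of_mul_le_mul_right h5 hnpos
  · -- `(m k) #Bad ≤ (8k/ν²) N`
    push_cast
    have hX : 0 ≤ (k : ℝ) * (Bad * (n : ℝ) ^ 2) := by positivity
    have h1 : (m : ℝ) * k * Bad * (n : ℝ) ^ 2 ≤ α * k * (E * N) := by
      calc (m : ℝ) * k * Bad * (n : ℝ) ^ 2 = m * (k * (Bad * (n : ℝ) ^ 2)) := by ring
        _ ≤ (α * n) * (k * (Bad * (n : ℝ) ^ 2)) := mul_le_mul_of_nonneg_right hm_le hX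
        _ = α * k * (Bad * (n : ℝ) ^ 3) := by ring
        _ ≤ α * k * (E * N) := mul_le_mul_of_nonneg_left hBad3 (by positivity)
    have hν2 : 0 < ν ^ 2 := by positivity
    have hαE : α * E ≤ n / ν ^ 2 := by
      rw [le_div_iff₀ hν2]; linarith only [hC8]
    have h2 : α * k * (E * N) ≤ k * (n / ν ^ 2) * N := by
      have := mul_le_mul_of_nonneg_left hαE (show (0 : ℝ) ≤ k * N by positivity)
      calc α * k * (E * N) = k * N * (α * E) := by ring
        _ ≤ k * N * (n / ν ^ 2) := this
        _ = k * (n / ν ^ 2) * N := by ring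
    have hn2 : (n : ℝ) ≤ 8 * (n : ℝ) ^ 2 := by
      have h := le_mul_of_one_le_right hnpos.le hnR
      have hsq : (n : ℝ) * n = (n : ℝ) ^ 2 := (sq _).symm
      have hnn : 0 ≤ (n : ℝ) ^ 2 := sq_nonneg _
      linarith only [h, hsq, hnn]
    have h3 : (m : ℝ) * k * Bad * (n : ℝ) ^ 2 ≤ (8 * k / ν ^ 2 * N) * (n : ℝ) ^ 2 := by
      have hA : 0 ≤ k / ν ^ 2 * N := by positivity
      calc (m : ℝ) * k * Bad * (n : ℝ) ^ 2 ≤ α * k * (E * N) := h1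
        _ ≤ k * (n / ν ^ 2) * N := h2
        _ = (k / ν ^ 2 * N) * n := by ring
        _ ≤ (k / ν ^ 2 * N) * (8 * (n : ℝ) ^ 2) := mul_le_mul_of_nonneg_left hn2 hA
        _ = (8 * k / ν ^ 2 * N) * (n : ℝ) ^ 2 := by ring
    exact le_of_mul_le_mul_right h3 (by positivity)

end Bad

end Summit.PneNP.PneNP.Theorems
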